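import Literature.MathematicalPhysics.QuantumFieldTheory.Balaban1983to89.Node00.Record12Numerics

/-!
# NODE 00 (YM-PLAN Track A) — STAGE 12, ROW W12: THE `K ≥ 1` COUPLING WINDOW AT THE STAGE-12 RECORD AND AT `θ₀` —
# its EXACT level-0 form (an `iff`), the level-0-only sufficient condition, and the explicit bare coupling («the numerics»)

Cell `pub-ymgap`, seat `pub-ymgap-node00-def-K0a` (g2).  Row W12 of dag-lead's § K0′ COMPONENTS (director-ym LINE №108 (a), ref-H PROBE-ZT-ONE (a)):
«exhibit one run with `K ≥ 1` inside the coupling window at `theta12OfRecord`» — the non-vacuity conjunct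
`∃ γ₁ > 0, ∀ γ ∈ ]0, γ₁], ∃ P, 1 ≤ P.K ∧ ((datumOfRecord₁₂ F 2 θ h).C P).flow.InInterval γ P.K` of the crux K1′ `StabilityBAtRecordR12e`
(`Summits/QuantumFields/YangMills/Theses/BalabanUVNodes.lean`, rev 15) read at NODE 00's parameter of record `θ₀ = theta12OfRecord F N ζ Rz Zt`
(`Node00/Record12Numerics`).  [I] = [Balaban1987RG1].

WHAT THE WINDOW IS, IN KERNEL (read off the tree, then proved below).  At every Stage-12 parameter `θ` the flow of the run `P = ⟨K, m, g₀⟩` of the datum of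
record is the history GENERATED FORWARD by (0.18)∕(0.20) [I] from the bare coupling, `gOfRecord₁₀ θ.toStage9Params P = genSeq (betaOfRecord₉c …) g₀` (def-T's
`flow_g_datumOfRecord₁₂`, `rfl`): it reads neither the proviso witness `h`, nor `K`, nor `m`, nor any residual object (`ζ`, `Rz`, `Zt`, the Stage-5 residual).  Its
first step is `g₁ = solveCoupling (g₀⁻² − β₁(g₀))` and, ON THE BOX `]0, θ.γ]`, the β of record IS the MERGED β `betaMerged F (mergedTermFamilyMatT F N (TcOfRecord F N)
(chiFixed7 F N θ.ν) θ.εbg) θ.ρ8 θ.bV` (`betaOfMerged_of_mem`): the one-loop `limUnder` number `beta0OfMerged … θ.v₀` DROPS OUT of the window question.  Hence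
(§1–§2, `iff`s): **the run `⟨1, m, g₀⟩` is in the `]0, γ]`-window (`γ ≤ θ.γ`) iff `0 < g₀ ≤ γ` and `β_merged,1[g₀] ≤ g₀⁻² − γ⁻²`**, and **the K1′ conjunct holds at
`θ` iff `∃ γ₁ ∈ ]0, θ.γ], ∀ γ ∈ ]0, γ₁], ∃ g₀ ∈ ]0, γ], β_merged,1[g₀] ≤ g₀⁻² − γ⁻²`** (a run of any length `K ≥ 1` in the window restricts to its first step; `genSeq`
is prefix-independent).  At `θ₀` (§3): `γ = 1∕2`, threshold `γ⁻² = 4`, merged β at `(chiFixed7 numerics7OfRecord₁₂, εbg = 1)` through the continuous-version transport at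
the CHART OF RECORD `suChartMap N` — the right-hand side is RESIDUAL-FREE and its numerals are displayed.

LOCATED-W12 (honest).  `β_merged,1[g₀]` is the (1.22) second moment of `polLimit` — the `limUnder atTop` of the windowed finite-volume kernels of the level-1 merged term
𝓝₁ ((1.6)∕(1.21) [I]) — a LIMIT OBJECT of the transport of record: no numeral of `Stage12Numerics` touches it (`γ` only moves the threshold `γ⁻²`; `ν`, `εbg` enter the
term family, not as bounds), and no lemma of the tree bounds it (dag-ref-H N109-ANSWER species).  So «numerics» CANNOT exhibit the run unconditionally; the printed
input that does is [I] p. 264 «β … uniformly bounded on this interval» AT LEVEL 0 ONLY — strictly less than the all-level `FlowStep.BetaUpperH` from which seat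
dag-n24's `N24_window_allK_of_betaUpperH` (`Node00/N24WindowK`) already produces runs of every length.  WHAT THE NUMERICS GIVE (§1 `…_of_level0Upper`): once a
level-0 bound `β⁺` on `]0, γ₁]` is in hand, the EXPLICIT bare coupling `g₀ := (γ⁻² + max(β⁺, 0))^{-1∕2}` (at `θ₀`, `γ = ½`: `1∕√(4 + max(β⁺, 0))`) runs one step
inside `]0, γ]`, with `g₁ = (γ⁻² + max(β⁺,0) − β_merged,1[g₀])^{-1∕2}`.  A NECESSARY condition is displayed too (§1 `sq_mul_betaMerged_lt_one_of_window`): along the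
window's witnesses `g₀² · β_merged,1[g₀] < 1` — a test for the disprover (a level-0 merged β dominating `g⁻²` near `0⁺` kills the conjunct at that `θ`).

CONTENTS (theorems only; no `def`, no instance, no notation):
* §1 flow side over `FlowStep.HBeta`: `solveCoupling_window_iff`, `genSeq_one`, `inInterval_one_genSeq_iff`, `inInterval_one_betaOfMerged_iff`,
  `inInterval_one_betaOfMerged_of_level0Upper`, `window_genSeq_iff`, `window_betaOfMerged_iff`, `window_betaOfMerged_of_level0Upper`,
  `sq_mul_betaMerged_lt_one_of_window`.
* §2 at a Stage-9∕12 parameter: `gOfRecord₁₀_one`, `inInterval_one_gOfRecord₁₀_iff`, `flow_inInterval_datumOfRecord₁₂_iff`, `window₁₂_iff`,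
  `inInterval_one_datumOfRecord₁₂_of_level0Upper`, `window₁₂_of_level0Upper`, `window₁₂_of_betaUpper_level0`, `window₁₂_of_betaUpperH`.
* §3 at `θ₀` and at the maker: `gOfRecord₁₀_theta12OfRecord`, `inInterval_one_theta12OfRecord_iff`, `window_theta12OfRecord_iff`,
  `inInterval_one_theta12OfRecord_of_level0Upper`, `inInterval_half_theta12OfRecord_of_level0Upper`, `window_theta12OfRecord_of_level0Upper`,
  `inInterval_one_stage12OfNumerics_iff`.

HONEST FRAMING.  Elementary real arithmetic on (0.20) [I] + bookkeeping at the record; NOTHING of Bałaban is asserted; the β bound is a HYPOTHESIS where it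
appears; NOT a discharge of any node or crux; counts unmoved; one finite 𝕋⁴ programme at fixed ε — NOT continuum ∕ OS ∕ mass gap ∕ Clay.
-/

noncomputable section

open scoped Matrix.Norms.L2Operator

namespace Literature.MathematicalPhysics.QuantumFieldTheory.Balaban1983to89.Node00

open T4Continuum FlowStep FlowStepRuns DagBinding T4DatumAssembly

/-! ## §1. Flow side: the one-step window is ONE inequality on `β₁` at the bare coupling -/

section FlowSide

/-- Elementary: for positive `g`, `γ`, `γ⁻² ≤ g⁻²` gives `g ≤ γ`. [folklore] -/
private theorem W12_le_of_one_div_sq_le {g γ : ℝ} (hg : 0 < g) (hγ : 0 < γ) (h : 1 / γ ^ 2 ≤ 1 / g ^ 2) : g ≤ γ := by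
  have h2 : g ^ 2 ≤ γ ^ 2 := (one_div_le_one_div (pow_pos hγ 2) (pow_pos hg 2)).1 h
  nlinarith [h2, hg, hγ]

/-- A run in the window up to step `K` is in the window up to any earlier step. [folklore] -/
private theorem W12_inInterval_of_le {γ : ℝ} {K K' : ℕ} {g : ℕ → ℝ} (h : Step.InInterval γ K g) (hK : K' ≤ K) :
    Step.InInterval γ K' g :=
  fun k hk => h k (hk.trans hK)

/-- The one-point history `[g₀]` lies in the box `]0, γ]¹` iff `0 < g₀ ≤ γ`. [folklore] -/
private theorem W12_const_mem_box_iff {γ g0 : ℝ} : (fun _ : Fin 1 => g0) ∈ Box γ 0 ↔ 0 < g0 ∧ g0 ≤ γ := by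
  rw [mem_box]
  exact ⟨fun h => h 0, fun h _ => h⟩

/-- **The next coupling lands in `]0, γ]` iff the right side of (0.20) is at least `γ⁻²`**: for `γ > 0`,
`0 < solveCoupling y ≤ γ ↔ γ⁻² ≤ y` (`solveCoupling y = y^{-1∕2}` for `y > 0`, junk `0` otherwise — excluded by `0 < ·`).
[cite: Balaban1987RG1, (0.18)–(0.20) pp.255–256 (elementary)] -/
theorem solveCoupling_window_iff {γ : ℝ} (hγ : 0 < γ) (y : ℝ) :
    (0 < solveCoupling y ∧ solveCoupling y ≤ γ) ↔ 1 / γ ^ 2 ≤ y := by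
  constructor
  · rintro ⟨hpos, hle⟩
    have hy : 0 < y := by
      by_contra h
      exact absurd (solveCoupling_nonpos (not_lt.mp h)) (not_le.mpr hpos)
    rw [← inv_sq_solveCoupling hy]
    exact one_div_le_one_div_of_le (pow_pos hpos 2) (by nlinarith)
  · intro h
    have hy : 0 < y := lt_of_lt_of_le (by positivity) h
    have hpos := solveCoupling_pos hy
    refine ⟨hpos, W12_le_of_one_div_sq_le hpos hγ ?_⟩
    rw [inv_sq_solveCoupling hy]
    exact h

/-- The first generated coupling: `g₁ = solveCoupling (g₀⁻² − β₁(g₀))` ((0.20) at `k = 0`, history `[g₀]`).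
[cite: Balaban1987RG1, (0.18)–(0.20) pp.255–256] -/
theorem genSeq_one (β : HBeta) (g0 : ℝ) :
    genSeq β g0 1 = solveCoupling (1 / g0 ^ 2 - β 0 (fun _ => g0)) := by
  have hp : prefixOf (genSeq β g0) 0 = fun _ => g0 := by
    funext i
    have hi : (i : ℕ) = 0 := by have := i.isLt; omega
    rw [prefixOf_apply, hi, genSeq_zero]
  show genSeq β g0 (0 + 1) = _
  rw [genSeq_succ, hp, genSeq_zero]

/-- **THE ONE-STEP WINDOW IS ONE INEQUALITY.**  The run generated from `g₀` satisfies `0 < g_k ≤ γ` for `k = 0, 1` iff `0 < g₀ ≤ γ` and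
`β₁(g₀) ≤ g₀⁻² − γ⁻²` (then `g₁ = (g₀⁻² − β₁(g₀))^{-1∕2} ∈ ]0, γ]`; the junk branch `g₁ = 0` of `solveCoupling` is excluded by `0 < g₁`).
[cite: Balaban1987RG1, (0.18)–(0.20) pp.255–256 and Thm 1 p.259 (the interval hypothesis; elementary)] -/
theorem inInterval_one_genSeq_iff (β : HBeta) {γ : ℝ} (hγ : 0 < γ) (g0 : ℝ) :
    Step.InInterval γ 1 (genSeq β g0) ↔ (0 < g0 ∧ g0 ≤ γ) ∧ β 0 (fun _ => g0) ≤ 1 / g0 ^ 2 - 1 / γ ^ 2 := by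
  constructor
  · intro h
    have h0 := h 0 (Nat.zero_le 1)
    have h1 := h 1 le_rfl
    rw [genSeq_zero] at h0
    rw [genSeq_one, solveCoupling_window_iff hγ] at h1
    exact ⟨h0, by linarith⟩
  · rintro ⟨h0, hβ⟩ k hk
    rcases Nat.le_one_iff_eq_zero_or_eq_one.mp hk with rfl | rfl
    · rw [genSeq_zero]
      exact h0
    · rw [genSeq_one, solveCoupling_window_iff hγ]
      linarith

/-- **Under the box convention of record the one-step window does NOT read the one-loop number `β⁰`**: for
`β := betaOfMerged βm β⁰ γθ` (equal to the merged β `βm` ON the box `]0, γθ]^{k+1}`, to `β⁰` off it) and `γ ≤ γθ`, the run from `g₀` is in the `]0, γ]`-window up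
to step 1 iff `0 < g₀ ≤ γ` and `βm₁(g₀) ≤ g₀⁻² − γ⁻²`. [cite: Balaban1987RG1, (0.18)–(0.20) pp.255–256, (1.22) p.264, (2.12)–(2.14) p.268 (box convention; elementary)] -/
theorem inInterval_one_betaOfMerged_iff (βm : HBeta) (β0 : ℕ → ℝ) {γθ γ : ℝ} (hγ : 0 < γ) (hγθ : γ ≤ γθ) (g0 : ℝ) :
    Step.InInterval γ 1 (genSeq (betaOfMerged βm β0 γθ) g0) ↔
      (0 < g0 ∧ g0 ≤ γ) ∧ βm 0 (fun _ => g0) ≤ 1 / g0 ^ 2 - 1 / γ ^ 2 := by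
  rw [inInterval_one_genSeq_iff _ hγ]
  refine and_congr_right fun h0 => ?_
  rw [betaOfMerged_of_mem _ _ _ (W12_const_mem_box_iff.mpr ⟨h0.1, h0.2.trans hγθ⟩)]

/-- **THE NUMERICS.**  Given a LEVEL-0 upper bound `βm₁(g) ≤ β⁺` for `g ∈ ]0, γ₁]`, `γ₁ ≤ γθ`: for every `γ ∈ ]0, γ₁]` the EXPLICIT bare coupling
`g₀ := solveCoupling (γ⁻² + max(β⁺, 0)) = (γ⁻² + max(β⁺, 0))^{-1∕2}` (`≤ γ`) runs one step inside `]0, γ]`: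
`g₁⁻² = γ⁻² + max(β⁺,0) − βm₁(g₀) ≥ γ⁻²`. [cite: Balaban1987RG1, (0.18)–(0.20) pp.255–256 and p.264 («uniformly bounded»; elementary consequence)] -/
theorem inInterval_one_betaOfMerged_of_level0Upper (βm : HBeta) (β0 : ℕ → ℝ) {γθ γ₁ βup : ℝ} (hγ₁ : γ₁ ≤ γθ)
    (hup : ∀ g : ℝ, 0 < g → g ≤ γ₁ → βm 0 (fun _ => g) ≤ βup) {γ : ℝ} (hγ : 0 < γ) (hγle : γ ≤ γ₁) :
    Step.InInterval γ 1 (genSeq (betaOfMerged βm β0 γθ) (solveCoupling (1 / γ ^ 2 + max βup 0))) := by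
  have hB : 0 ≤ max βup 0 := le_max_right _ _
  have hy : 0 < 1 / γ ^ 2 + max βup 0 := by positivity
  have hpos : 0 < solveCoupling (1 / γ ^ 2 + max βup 0) := solveCoupling_pos hy
  have hsq : 1 / (solveCoupling (1 / γ ^ 2 + max βup 0)) ^ 2 = 1 / γ ^ 2 + max βup 0 := inv_sq_solveCoupling hy
  have hle : solveCoupling (1 / γ ^ 2 + max βup 0) ≤ γ :=
    W12_le_of_one_div_sq_le hpos hγ (by rw [hsq]; exact le_add_of_nonneg_right hB)
  rw [inInterval_one_betaOfMerged_iff βm β0 hγ (hγle.trans hγ₁)]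
  refine ⟨⟨hpos, hle⟩, ?_⟩
  rw [hsq]
  have h := hup _ hpos (hle.trans hγle)
  linarith [le_max_left βup 0]

/-- **THE K1′ WINDOW CONJUNCT OVER A FORWARD-GENERATED FLOW IS A LEVEL-0 CONDITION** (`genSeq` reads neither `K` nor `m`; a run of length `K ≥ 1` in the window
restricts to its first step, and a one-step run is a run): `(∃ γ₁ > 0, ∀ γ ∈ ]0, γ₁], ∃ P, 1 ≤ P.K ∧ 0 < g_k(P) ≤ γ ∀ k ≤ P.K) ↔
(∃ γ₁ > 0, ∀ γ ∈ ]0, γ₁], ∃ g₀ ∈ ]0, γ], β₁(g₀) ≤ g₀⁻² − γ⁻²)`. [cite: Balaban1987RG1, (0.17)–(0.20) pp.255–256 (elementary)] -/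
theorem window_genSeq_iff (β : HBeta) :
    (∃ γ₁ : ℝ, 0 < γ₁ ∧ ∀ γ : ℝ, 0 < γ → γ ≤ γ₁ → ∃ P : B12.RunParams, 1 ≤ P.K ∧ Step.InInterval γ P.K (genSeq β P.g0)) ↔
      ∃ γ₁ : ℝ, 0 < γ₁ ∧ ∀ γ : ℝ, 0 < γ → γ ≤ γ₁ →
        ∃ g0 : ℝ, (0 < g0 ∧ g0 ≤ γ) ∧ β 0 (fun _ => g0) ≤ 1 / g0 ^ 2 - 1 / γ ^ 2 := by
  refine exists_congr fun γ₁ => and_congr_right fun _ => forall₃_congr fun γ hγ _ => ?_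
  constructor
  · rintro ⟨P, hK, hI⟩
    exact ⟨P.g0, (inInterval_one_genSeq_iff β hγ P.g0).mp (W12_inInterval_of_le hI hK)⟩
  · rintro ⟨g0, h⟩
    exact ⟨⟨1, 0, g0⟩, le_rfl, (inInterval_one_genSeq_iff β hγ g0).mpr h⟩

/-- **… and under the box convention of record it reads the MERGED β at level 0 only** (`γ₁` may be taken `≤ γθ`; `β⁰` unread).
[cite: Balaban1987RG1, (0.17)–(0.20) pp.255–256, (1.22) p.264, (2.12)–(2.14) p.268 (elementary)] -/
theorem window_betaOfMerged_iff (βm : HBeta) (β0 : ℕ → ℝ) {γθ : ℝ} (hγθ : 0 < γθ) :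
    (∃ γ₁ : ℝ, 0 < γ₁ ∧ ∀ γ : ℝ, 0 < γ → γ ≤ γ₁ →
        ∃ P : B12.RunParams, 1 ≤ P.K ∧ Step.InInterval γ P.K (genSeq (betaOfMerged βm β0 γθ) P.g0)) ↔
      ∃ γ₁ : ℝ, 0 < γ₁ ∧ γ₁ ≤ γθ ∧ ∀ γ : ℝ, 0 < γ → γ ≤ γ₁ →
        ∃ g0 : ℝ, (0 < g0 ∧ g0 ≤ γ) ∧ βm 0 (fun _ => g0) ≤ 1 / g0 ^ 2 - 1 / γ ^ 2 := by
  rw [window_genSeq_iff]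
  constructor
  · rintro ⟨γ₁, hγ₁, h⟩
    refine ⟨min γ₁ γθ, lt_min hγ₁ hγθ, min_le_right _ _, fun γ hγ hγle => ?_⟩
    obtain ⟨g0, h0, hβ⟩ := h γ hγ (hγle.trans (min_le_left _ _))
    refine ⟨g0, h0, ?_⟩
    rwa [betaOfMerged_of_mem _ _ _ (W12_const_mem_box_iff.mpr ⟨h0.1, h0.2.trans (hγle.trans (min_le_right _ _))⟩)] at hβ
  · rintro ⟨γ₁, hγ₁, hγ₁θ, h⟩
    refine ⟨γ₁, hγ₁, fun γ hγ hγle => ?_⟩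
    obtain ⟨g0, h0, hβ⟩ := h γ hγ hγle
    refine ⟨g0, h0, ?_⟩
    rwa [betaOfMerged_of_mem _ _ _ (W12_const_mem_box_iff.mpr ⟨h0.1, h0.2.trans (hγle.trans hγ₁θ)⟩)]

/-- **SUFFICIENT: a level-0 upper bound of the merged β on some `]0, γ₁]`, `γ₁ ≤ γθ`, gives the conjunct** — witnessed at every `γ ∈ ]0, γ₁]` by the EXPLICIT
one-step run `⟨1, 0, (γ⁻² + max(β⁺,0))^{-1∕2}⟩`. [cite: Balaban1987RG1, (0.17)–(0.20) pp.255–256 and p.264 (elementary consequence of the printed upper bound, level 0)] -/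
theorem window_betaOfMerged_of_level0Upper (βm : HBeta) (β0 : ℕ → ℝ) {γθ γ₁ βup : ℝ} (hγ₁ : 0 < γ₁) (hγ₁θ : γ₁ ≤ γθ)
    (hup : ∀ g : ℝ, 0 < g → g ≤ γ₁ → βm 0 (fun _ => g) ≤ βup) :
    ∃ γ₁ : ℝ, 0 < γ₁ ∧ ∀ γ : ℝ, 0 < γ → γ ≤ γ₁ →
      ∃ P : B12.RunParams, 1 ≤ P.K ∧ Step.InInterval γ P.K (genSeq (betaOfMerged βm β0 γθ) P.g0) :=
  ⟨γ₁, hγ₁, fun γ hγ hγle => ⟨⟨1, 0, solveCoupling (1 / γ ^ 2 + max βup 0)⟩, le_rfl,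
    inInterval_one_betaOfMerged_of_level0Upper βm β0 hγ₁θ hup hγ hγle⟩⟩

/-- **NECESSARY: along the window's witnesses the merged β stays below `g⁻²`** — if the conjunct holds then for all small `γ` some `g₀ ∈ ]0, γ]` has
`g₀² · βm₁(g₀) < 1` (indeed `≤ 1 − g₀²∕γ²`).  A test: a level-0 merged β dominating `g⁻²` near `0⁺` refutes the conjunct at that parameter.
[cite: Balaban1987RG1, (0.17)–(0.20) pp.255–256 (elementary)] -/
theorem sq_mul_betaMerged_lt_one_of_window (βm : HBeta) (β0 : ℕ → ℝ) {γθ : ℝ} (hγθ : 0 < γθ)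
    (h : ∃ γ₁ : ℝ, 0 < γ₁ ∧ ∀ γ : ℝ, 0 < γ → γ ≤ γ₁ →
      ∃ P : B12.RunParams, 1 ≤ P.K ∧ Step.InInterval γ P.K (genSeq (betaOfMerged βm β0 γθ) P.g0)) :
    ∃ γ₁ : ℝ, 0 < γ₁ ∧ γ₁ ≤ γθ ∧ ∀ γ : ℝ, 0 < γ → γ ≤ γ₁ →
      ∃ g0 : ℝ, (0 < g0 ∧ g0 ≤ γ) ∧ g0 ^ 2 * βm 0 (fun _ => g0) < 1 := by
  obtain ⟨γ₁, hγ₁, hγ₁θ, hw⟩ := (window_betaOfMerged_iff βm β0 hγθ).mp h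
  refine ⟨γ₁, hγ₁, hγ₁θ, fun γ hγ hγle => ?_⟩
  obtain ⟨g0, h0, hβ⟩ := hw γ hγ hγle
  refine ⟨g0, h0, ?_⟩
  have hg2 : 0 < g0 ^ 2 := pow_pos h0.1 2
  have h1 : g0 ^ 2 * (1 / g0 ^ 2) = 1 := by rw [mul_one_div, div_self (ne_of_gt hg2)]
  have h2 : 0 < g0 ^ 2 * (1 / γ ^ 2) := by positivity
  have h3 : g0 ^ 2 * βm 0 (fun _ => g0) ≤ g0 ^ 2 * (1 / g0 ^ 2 - 1 / γ ^ 2) := mul_le_mul_of_nonneg_left hβ hg2.le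
  nlinarith

end FlowSide

/-! ## §2. At a Stage-9 ∕ Stage-12 parameter: the window reads the level-0 MERGED β of record and nothing else -/

section Record

variable (F : T4Family) (N : ℕ) [NeZero N]

/-- The Stage-10 history at step 1: `g₁ = solveCoupling (g₀⁻² − β₁(g₀))` with `β = betaOfRecord₁₀ θ`. [cite: Balaban1987RG1, (0.18)–(0.20) pp.255–256 (bookkeeping)] -/
theorem gOfRecord₁₀_one (θ : Stage9Params F N) (p : B12.RunParams) :
    gOfRecord₁₀ F N θ p 1 = solveCoupling (1 / p.g0 ^ 2 - betaOfRecord₁₀ F N θ 0 (fun _ => p.g0)) :=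
  genSeq_one _ _

/-- **AT EVERY STAGE-9 PARAMETER `θ` (hence every Stage-12 one via `toStage9Params`): the one-step window `0 < g₀, g₁ ≤ γ` (`γ ≤ θ.γ`) of the run `p`
reads ONLY the level-0 MERGED β of record — `betaMerged F (mergedTermFamilyMatT F N (TcOfRecord F N) (chiFixed7 F N θ.ν) θ.εbg) θ.ρ8 θ.bV` at the in-box history
`[g₀]` — and is the single inequality `βm₁(g₀) ≤ g₀⁻² − γ⁻²`** (`betaOfRecord₁₀ = betaOfRecord₉c = betaOfRecord₈T (TcOfRecord) θ.toStage8Params = betaOfMerged βm β⁰ θ.γ`;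
the one-loop number `β⁰ = beta0OfMerged βm θ.v₀` is NOT read). [cite: Balaban1987RG1, (0.18)–(0.20) pp.255–256, (1.20)–(1.22) p.264, (2.12)–(2.14) p.268 (bookkeeping + elementary)] -/
theorem inInterval_one_gOfRecord₁₀_iff (θ : Stage9Params F N) {γ : ℝ} (hγ : 0 < γ) (hγθ : γ ≤ θ.γ) (p : B12.RunParams) :
    Step.InInterval γ 1 (gOfRecord₁₀ F N θ p) ↔
      (0 < p.g0 ∧ p.g0 ≤ γ) ∧
        (letI := θ.instVβ₁; letI := θ.instVβ₂; letI := θ.instιβ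
         betaMerged F (mergedTermFamilyMatT F N (TcOfRecord F N) (chiFixed7 F N θ.ν) θ.εbg) θ.ρ8 θ.bV 0 (fun _ => p.g0) ≤
           1 / p.g0 ^ 2 - 1 / γ ^ 2) := by
  show Step.InInterval γ 1 (genSeq (betaOfRecord₈T F N (TcOfRecord F N) θ.toStage8Params) p.g0) ↔ _
  unfold betaOfRecord₈T
  exact inInterval_one_betaOfMerged_iff _ _ hγ hγθ p.g0

/-- **At the datum of record, for EVERY proviso witness `h`: B16's window clause of the run `P` IS the raw-sequence clause on `gOfRecord₁₀ θ.toStage9Params P`**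
(def-T's face `flow_g_datumOfRecord₁₂`; `Iff.rfl`) — the window does not read `h`. [cite: Balaban1987RG1, (0.17)–(0.20) pp.255–256 and Thm 1 p.259 (bookkeeping)] -/
theorem flow_inInterval_datumOfRecord₁₂_iff (θ : Stage12Params F N) (h : θ.Provisos₁₂ F N) (γ : ℝ) (P : B12.RunParams) (K : ℕ) :
    ((datumOfRecord₁₂ F N θ h).C P).flow.InInterval γ K ↔ Step.InInterval γ K (gOfRecord₁₀ F N θ.toStage9Params P) :=
  Iff.rfl

/-- **THE K1′ WINDOW CONJUNCT AT A STAGE-12 RECORD ↔ THE LEVEL-0 MERGED-β CONDITION** (`0 < θ.γ`; every `h`):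
`(∃ γ₁ > 0, ∀ γ ∈ ]0, γ₁], ∃ P, 1 ≤ P.K ∧ ((datumOfRecord₁₂ F N θ h).C P).flow.InInterval γ P.K) ↔
(∃ γ₁ ∈ ]0, θ.γ], ∀ γ ∈ ]0, γ₁], ∃ g₀ ∈ ]0, γ], βm₁(g₀) ≤ g₀⁻² − γ⁻²)` — ONE real inequality per `(γ, g₀)` on the (1.22) second moment of the limiting level-1 kernel
of the merged term through the continuous-version transport; no residual object, no proviso, no other numeral of `θ` is read.
[cite: Balaban1987RG1, (0.17)–(0.20) pp.255–256, (1.20)–(1.22) p.264, (2.12)–(2.14) p.268 (bookkeeping + elementary)] -/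
theorem window₁₂_iff (θ : Stage12Params F N) (h : θ.Provisos₁₂ F N) (hγθ : 0 < θ.γ) :
    (∃ γ₁ : ℝ, 0 < γ₁ ∧ ∀ γ : ℝ, 0 < γ → γ ≤ γ₁ →
        ∃ P : B12.RunParams, 1 ≤ P.K ∧ ((datumOfRecord₁₂ F N θ h).C P).flow.InInterval γ P.K) ↔
      ∃ γ₁ : ℝ, 0 < γ₁ ∧ γ₁ ≤ θ.γ ∧ ∀ γ : ℝ, 0 < γ → γ ≤ γ₁ →
        ∃ g0 : ℝ, (0 < g0 ∧ g0 ≤ γ) ∧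
          (letI := θ.instVβ₁; letI := θ.instVβ₂; letI := θ.instιβ
           betaMerged F (mergedTermFamilyMatT F N (TcOfRecord F N) (chiFixed7 F N θ.ν) θ.εbg) θ.ρ8 θ.bV 0 (fun _ => g0) ≤
             1 / g0 ^ 2 - 1 / γ ^ 2) := by
  show (∃ γ₁ : ℝ, 0 < γ₁ ∧ ∀ γ : ℝ, 0 < γ → γ ≤ γ₁ → ∃ P : B12.RunParams, 1 ≤ P.K ∧
      Step.InInterval γ P.K (genSeq (betaOfRecord₈T F N (TcOfRecord F N) θ.toStage8Params) P.g0)) ↔ _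
  unfold betaOfRecord₈T
  exact window_betaOfMerged_iff _ _ hγθ

/-- **THE NUMERICS AT A STAGE-12 RECORD.**  Under a LEVEL-0 upper bound `βm₁(g) ≤ β⁺` on `]0, γ₁]`, `γ₁ ≤ θ.γ`: for every `γ ∈ ]0, γ₁]` and every torus exponent `m`
the EXPLICIT run `⟨1, m, (γ⁻² + max(β⁺,0))^{-1∕2}⟩` of the datum of record is in the `]0, γ]`-window. [cite: Balaban1987RG1, (0.17)–(0.20) pp.255–256 and p.264 (elementary consequence, level 0)] -/
theorem inInterval_one_datumOfRecord₁₂_of_level0Upper (θ : Stage12Params F N) (h : θ.Provisos₁₂ F N) {γ₁ βup : ℝ} (hγ₁θ : γ₁ ≤ θ.γ)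
    (hup : ∀ g : ℝ, 0 < g → g ≤ γ₁ →
      (letI := θ.instVβ₁; letI := θ.instVβ₂; letI := θ.instιβ
       betaMerged F (mergedTermFamilyMatT F N (TcOfRecord F N) (chiFixed7 F N θ.ν) θ.εbg) θ.ρ8 θ.bV 0 (fun _ => g) ≤ βup))
    (m : ℕ) {γ : ℝ} (hγ : 0 < γ) (hγle : γ ≤ γ₁) :
    ((datumOfRecord₁₂ F N θ h).C ⟨1, m, solveCoupling (1 / γ ^ 2 + max βup 0)⟩).flow.InInterval γ 1 := by
  show Step.InInterval γ 1 (genSeq (betaOfRecord₈T F N (TcOfRecord F N) θ.toStage8Params) (solveCoupling (1 / γ ^ 2 + max βup 0)))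
  unfold betaOfRecord₈T
  exact inInterval_one_betaOfMerged_of_level0Upper _ _ hγ₁θ hup hγ hγle

/-- **SUFFICIENT: a level-0 upper bound of the merged β of record on `]0, γ₁]`, `0 < γ₁ ≤ θ.γ`, gives the K1′ window conjunct at the record** (runs
`⟨1, m, (γ⁻² + max(β⁺,0))^{-1∕2}⟩`).  Strictly weaker input than the all-level `FlowStep.BetaUpperH` of `N24_window_allK_of_betaUpperH`.
[cite: Balaban1987RG1, (0.17)–(0.20) pp.255–256 and p.264 («uniformly bounded on this interval», level 0; elementary consequence)] -/
theorem window₁₂_of_level0Upper (θ : Stage12Params F N) (h : θ.Provisos₁₂ F N) {γ₁ βup : ℝ} (hγ₁ : 0 < γ₁) (hγ₁θ : γ₁ ≤ θ.γ)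
    (hup : ∀ g : ℝ, 0 < g → g ≤ γ₁ →
      (letI := θ.instVβ₁; letI := θ.instVβ₂; letI := θ.instιβ
       betaMerged F (mergedTermFamilyMatT F N (TcOfRecord F N) (chiFixed7 F N θ.ν) θ.εbg) θ.ρ8 θ.bV 0 (fun _ => g) ≤ βup)) (m : ℕ) :
    ∃ γ₁ : ℝ, 0 < γ₁ ∧ ∀ γ : ℝ, 0 < γ → γ ≤ γ₁ →
      ∃ P : B12.RunParams, 1 ≤ P.K ∧ ((datumOfRecord₁₂ F N θ h).C P).flow.InInterval γ P.K :=
  ⟨γ₁, hγ₁, fun γ hγ hγle => ⟨⟨1, m, solveCoupling (1 / γ ^ 2 + max βup 0)⟩, le_rfl,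
    inInterval_one_datumOfRecord₁₂_of_level0Upper F N θ h hγ₁θ hup m hγ hγle⟩⟩

/-- **SUFFICIENT, in the datum's β-currency: the LEVEL-0 SLICE of an upper box bound on `(datumOfRecord₁₂ F N θ h).βfun`** (`β₁(v) ≤ β⁺` for `v ∈ ]0, γ₀]¹`,
`0 < γ₀`, `0 < θ.γ`) gives the K1′ window conjunct (with `γ₁ := min γ₀ θ.γ`; on that box the β of record IS the merged β).
[cite: Balaban1987RG1, (0.17)–(0.20) pp.255–256, (1.22) p.264 (elementary consequence, level 0)] -/
theorem window₁₂_of_betaUpper_level0 (θ : Stage12Params F N) (h : θ.Provisos₁₂ F N) (hγθ : 0 < θ.γ) {γ₀ βup : ℝ} (hγ₀ : 0 < γ₀)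
    (hhi : ∀ v : Fin 1 → ℝ, v ∈ Box γ₀ 0 → (datumOfRecord₁₂ F N θ h).βfun 0 v ≤ βup) (m : ℕ) :
    ∃ γ₁ : ℝ, 0 < γ₁ ∧ ∀ γ : ℝ, 0 < γ → γ ≤ γ₁ →
      ∃ P : B12.RunParams, 1 ≤ P.K ∧ ((datumOfRecord₁₂ F N θ h).C P).flow.InInterval γ P.K := by
  refine window₁₂_of_level0Upper F N θ h (βup := βup) (lt_min hγ₀ hγθ) (min_le_right γ₀ θ.γ) (fun g hg hgle => ?_) m
  have hv := hhi (fun _ => g) (W12_const_mem_box_iff.mpr ⟨hg, hgle.trans (min_le_left _ _)⟩)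
  have hb : (datumOfRecord₁₂ F N θ h).βfun 0 (fun _ => g) =
      betaOfRecord₈T F N (TcOfRecord F N) θ.toStage8Params 0 (fun _ => g) := rfl
  rw [hb, betaOfRecord₈T, betaOfMerged_of_mem _ _ _ (W12_const_mem_box_iff.mpr ⟨hg, hgle.trans (min_le_right _ _)⟩)] at hv
  exact hv

/-- **Corollary (seat dag-n24's input, by name): the all-level `FlowStep.BetaUpperH β⁺ γ₀ (datumOfRecord₁₂ F N θ h).βfun` gives the conjunct** — only its level-0
slice is used. [cite: Balaban1987RG1, (0.17)–(0.20) pp.255–256 and p.264 (elementary consequence)] -/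
theorem window₁₂_of_betaUpperH (θ : Stage12Params F N) (h : θ.Provisos₁₂ F N) (hγθ : 0 < θ.γ) {γ₀ βup : ℝ} (hγ₀ : 0 < γ₀)
    (hhi : BetaUpperH βup γ₀ (datumOfRecord₁₂ F N θ h).βfun) (m : ℕ) :
    ∃ γ₁ : ℝ, 0 < γ₁ ∧ ∀ γ : ℝ, 0 < γ → γ ≤ γ₁ →
      ∃ P : B12.RunParams, 1 ≤ P.K ∧ ((datumOfRecord₁₂ F N θ h).C P).flow.InInterval γ P.K :=
  window₁₂_of_betaUpper_level0 F N θ h hγθ hγ₀ (fun v hv => hhi 0 v hv) m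

end Record

/-! ## §3. Row W12 at `θ₀ = theta12OfRecord F N ζ Rz Zt` (γ = 1∕2, threshold 4) and at the maker `stage12OfNumerics` -/

section Theta

variable (F : T4Family) (N : ℕ) [NeZero N]
variable (ζ : ZetaOfRecord F N numerics7OfRecord₁₂ 1) (Rz : (K : ℕ) → Sect2.Residual (F.P K) (MatA N)) (Zt : (K : ℕ) → TkResidualW F N (FluctV N) K)

/-- **The flow at `θ₀` is RESIDUAL-FREE**: the generated history of every run reads the Stage-8 part `stage8OfRecord₁₂ F N` only (`rfl`) — not `ζ`, `Rz`, `Zt`.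
[cite: Balaban1987RG1, (0.17)–(0.20) pp.255–256 (bookkeeping)] -/
theorem gOfRecord₁₀_theta12OfRecord (p : B12.RunParams) :
    gOfRecord₁₀ F N (theta12OfRecord F N ζ Rz Zt).toStage9Params p = genSeq (betaOfRecord₈c F N (stage8OfRecord₁₂ F N)) p.g0 :=
  rfl

/-- **ROW W12 AT `θ₀` — THE EXACT FORM.**  The run `⟨1, m, g₀⟩` at `θ₀` is inside the `]0, ½]`-window (`θ₀.γ = 1∕2`) iff `0 < g₀ ≤ ½` and the level-0 MERGED β
of record — at def-χ's fixed-threshold χ at `numerics7OfRecord₁₂`, background radius `εbg = 1`, through the continuous-version transport `TcOfRecord`, at the CHART OF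
RECORD `suChartMap N` with its standard basis — satisfies `βm₁(g₀) ≤ g₀⁻² − 4`.  The right side is RESIDUAL-FREE; its numerals are displayed; `βm₁(g₀)` is the (1.22)
second moment of the `polLimit` of the level-1 windowed kernels of the merged term (a limit object — LOCATED-W12, file header).
[cite: Balaban1987RG1, (0.18)–(0.20) pp.255–256, (1.20)–(1.22) p.264, (2.12)–(2.14) p.268 (bookkeeping + elementary)] -/
theorem inInterval_one_theta12OfRecord_iff (m : ℕ) (g0 : ℝ) :
    Step.InInterval (1 / 2) 1 (gOfRecord₁₀ F N (theta12OfRecord F N ζ Rz Zt).toStage9Params ⟨1, m, g0⟩) ↔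
      (0 < g0 ∧ g0 ≤ 1 / 2) ∧
        betaMerged F (mergedTermFamilyMatT F N (TcOfRecord F N) (chiFixed7 F N numerics7OfRecord₁₂) 1)
            (suChartMap N) (Pi.basisFun ℝ (Fin (suChartDim N))) 0 (fun _ => g0) ≤ 1 / g0 ^ 2 - 4 := by
  refine (inInterval_one_gOfRecord₁₀_iff F N (theta12OfRecord F N ζ Rz Zt).toStage9Params (γ := 1 / 2) (by norm_num)
    (show (1 / 2 : ℝ) ≤ 1 / 2 from le_rfl) ⟨1, m, g0⟩).trans ?_
  show (0 < g0 ∧ g0 ≤ 1 / 2) ∧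
      betaMerged F (mergedTermFamilyMatT F N (TcOfRecord F N) (chiFixed7 F N numerics7OfRecord₁₂) 1)
          (suChartMap N) (Pi.basisFun ℝ (Fin (suChartDim N))) 0 (fun _ => g0) ≤ 1 / g0 ^ 2 - 1 / (1 / 2) ^ 2 ↔ _
  norm_num

/-- **ROW W12 AT `θ₀` — THE K1′ WINDOW CONJUNCT ↔ THE LEVEL-0 CONDITION** (every proviso witness `h` of `θ₀`; `γ₁` may be taken `≤ ½`).
[cite: Balaban1987RG1, (0.17)–(0.20) pp.255–256, (1.20)–(1.22) p.264, (2.12)–(2.14) p.268 (bookkeeping + elementary)] -/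
theorem window_theta12OfRecord_iff (h : (theta12OfRecord F N ζ Rz Zt).Provisos₁₂ F N) :
    (∃ γ₁ : ℝ, 0 < γ₁ ∧ ∀ γ : ℝ, 0 < γ → γ ≤ γ₁ →
        ∃ P : B12.RunParams, 1 ≤ P.K ∧ ((datumOfRecord₁₂ F N (theta12OfRecord F N ζ Rz Zt) h).C P).flow.InInterval γ P.K) ↔
      ∃ γ₁ : ℝ, 0 < γ₁ ∧ γ₁ ≤ 1 / 2 ∧ ∀ γ : ℝ, 0 < γ → γ ≤ γ₁ →
        ∃ g0 : ℝ, (0 < g0 ∧ g0 ≤ γ) ∧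
          betaMerged F (mergedTermFamilyMatT F N (TcOfRecord F N) (chiFixed7 F N numerics7OfRecord₁₂) 1)
              (suChartMap N) (Pi.basisFun ℝ (Fin (suChartDim N))) 0 (fun _ => g0) ≤ 1 / g0 ^ 2 - 1 / γ ^ 2 :=
  window₁₂_iff F N (theta12OfRecord F N ζ Rz Zt) h (show (0 : ℝ) < 1 / 2 by norm_num)

/-- **ROW W12 AT `θ₀` — THE NUMERICS.**  Under a level-0 upper bound `βm₁(g) ≤ β⁺` on `]0, ½]` of the merged β of record at `θ₀`: for every `γ ∈ ]0, ½]` and every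
torus exponent `m`, the EXPLICIT run `⟨1, m, (γ⁻² + max(β⁺,0))^{-1∕2}⟩` at `θ₀` is in the `]0, γ]`-window. [cite: Balaban1987RG1, (0.17)–(0.20) pp.255–256 and p.264 (elementary consequence, level 0)] -/
theorem inInterval_one_theta12OfRecord_of_level0Upper {βup : ℝ}
    (hup : ∀ g : ℝ, 0 < g → g ≤ 1 / 2 →
      betaMerged F (mergedTermFamilyMatT F N (TcOfRecord F N) (chiFixed7 F N numerics7OfRecord₁₂) 1)
        (suChartMap N) (Pi.basisFun ℝ (Fin (suChartDim N))) 0 (fun _ => g) ≤ βup)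
    (m : ℕ) {γ : ℝ} (hγ : 0 < γ) (hγle : γ ≤ 1 / 2) :
    Step.InInterval γ 1 (gOfRecord₁₀ F N (theta12OfRecord F N ζ Rz Zt).toStage9Params ⟨1, m, solveCoupling (1 / γ ^ 2 + max βup 0)⟩) := by
  show Step.InInterval γ 1 (genSeq (betaOfRecord₈T F N (TcOfRecord F N) (stage8OfRecord₁₂ F N)) (solveCoupling (1 / γ ^ 2 + max βup 0)))
  unfold betaOfRecord₈T
  exact inInterval_one_betaOfMerged_of_level0Upper _ _ (show (1 / 2 : ℝ) ≤ (stage8OfRecord₁₂ F N).γ from le_rfl) hup hγ hγle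

/-- **… at `γ = ½` itself: the bare coupling `1∕√(4 + max(β⁺,0))`** (`solveCoupling (4 + max(β⁺,0))`) runs one step inside `]0, ½]` at `θ₀`.
[cite: Balaban1987RG1, (0.17)–(0.20) pp.255–256 and p.264 (elementary consequence, level 0)] -/
theorem inInterval_half_theta12OfRecord_of_level0Upper {βup : ℝ}
    (hup : ∀ g : ℝ, 0 < g → g ≤ 1 / 2 →
      betaMerged F (mergedTermFamilyMatT F N (TcOfRecord F N) (chiFixed7 F N numerics7OfRecord₁₂) 1)
        (suChartMap N) (Pi.basisFun ℝ (Fin (suChartDim N))) 0 (fun _ => g) ≤ βup) (m : ℕ) :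
    Step.InInterval (1 / 2) 1 (gOfRecord₁₀ F N (theta12OfRecord F N ζ Rz Zt).toStage9Params ⟨1, m, solveCoupling (4 + max βup 0)⟩) := by
  have h := inInterval_one_theta12OfRecord_of_level0Upper F N ζ Rz Zt hup m (γ := 1 / 2) (by norm_num) le_rfl
  norm_num at h
  exact h

/-- **ROW W12 AT `θ₀` — THE K1′ CONJUNCT FROM THE LEVEL-0 BOUND** (every proviso witness `h`; `γ₁ := ½`; runs `⟨1, m, (γ⁻² + max(β⁺,0))^{-1∕2}⟩`).
[cite: Balaban1987RG1, (0.17)–(0.20) pp.255–256 and p.264 (elementary consequence, level 0)] -/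
theorem window_theta12OfRecord_of_level0Upper (h : (theta12OfRecord F N ζ Rz Zt).Provisos₁₂ F N) {βup : ℝ}
    (hup : ∀ g : ℝ, 0 < g → g ≤ 1 / 2 →
      betaMerged F (mergedTermFamilyMatT F N (TcOfRecord F N) (chiFixed7 F N numerics7OfRecord₁₂) 1)
        (suChartMap N) (Pi.basisFun ℝ (Fin (suChartDim N))) 0 (fun _ => g) ≤ βup) (m : ℕ) :
    ∃ γ₁ : ℝ, 0 < γ₁ ∧ ∀ γ : ℝ, 0 < γ → γ ≤ γ₁ →
      ∃ P : B12.RunParams, 1 ≤ P.K ∧ ((datumOfRecord₁₂ F N (theta12OfRecord F N ζ Rz Zt) h).C P).flow.InInterval γ P.K :=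
  ⟨1 / 2, by norm_num, fun γ hγ hγle => ⟨⟨1, m, solveCoupling (1 / γ ^ 2 + max βup 0)⟩, le_rfl,
    inInterval_one_theta12OfRecord_of_level0Upper F N ζ Rz Zt hup m hγ hγle⟩⟩

/-- **AT THE GENERIC MAKER `stage12OfNumerics F N n res ζ Rz Zt`** (a `bg` proof instantiating other numerics): the one-step window reads, of the numerics `n`, ONLY
`(ν, εbg)` (inside the merged term family) and `γ` (the threshold `γ⁻²`); of the residual objects, NOTHING.  Exact form for `γ ≤ n.γ`.
[cite: Balaban1987RG1, (0.18)–(0.20) pp.255–256, (1.20)–(1.22) p.264, (2.12)–(2.14) p.268 (bookkeeping + elementary)] -/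
theorem inInterval_one_stage12OfNumerics_iff (n : Stage12Numerics) (res : Residual₅ F N) (ζ' : ZetaOfRecord F N n.ν n.τ9.M)
    (Rz' : (K : ℕ) → Sect2.Residual (F.P K) (MatA N)) (Zt' : (K : ℕ) → TkResidualW F N (FluctV N) K)
    {γ : ℝ} (hγ : 0 < γ) (hγn : γ ≤ n.γ) (m : ℕ) (g0 : ℝ) :
    Step.InInterval γ 1 (gOfRecord₁₀ F N (stage12OfNumerics F N n res ζ' Rz' Zt').toStage9Params ⟨1, m, g0⟩) ↔
      (0 < g0 ∧ g0 ≤ γ) ∧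
        betaMerged F (mergedTermFamilyMatT F N (TcOfRecord F N) (chiFixed7 F N n.ν) n.εbg)
            (suChartMap N) (Pi.basisFun ℝ (Fin (suChartDim N))) 0 (fun _ => g0) ≤ 1 / g0 ^ 2 - 1 / γ ^ 2 :=
  inInterval_one_gOfRecord₁₀_iff F N (stage12OfNumerics F N n res ζ' Rz' Zt').toStage9Params hγ hγn ⟨1, m, g0⟩

end Theta

end Literature.MathematicalPhysics.QuantumFieldTheory.Balaban1983to89.Node00

end
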